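import Summits.HubbardSuperconductivity.HubbardSuperconductivity.Theorems.AnisotropyChordTransferFibre3RowDLoopTables
import Summits.HubbardSuperconductivity.HubbardSuperconductivity.Theorems.AnisotropyChordTransferFibre3ManifoldA64

/-!
# Route `AnisotropyChord` / H0 rotor rung, row D (KT-2a) on the t-BLOCKS: block twin of `…AnisotropyChordTransferFibre3RowDLoopTables`

T-FORK (p2 g8; inventory memo HOME/hubbard-h0-rotor-p2/TBLOCK-INVENTORY-g8.md §3): the theorems of `…RowDLoopTables` that carry the
hypothesis `128 ≤ L` (or the `L2.NamedCell` cell box) restated in the namespace `RowD.T` with the SAME names for the t-blocks of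
the range `48 ≤ L < 128` (route-lead ruling R1): analytic layer with `64 ≤ L` (family A at `L ≥ 64`: `ManifoldA.nu_ceiling64`,
`manifold_band64`), cell layer on block cells `c : L2.TCell` (`cellBoxB (c.box a₁ a₂)`, `pmem_xTrueT`,
`RowC.finalVec_mem_of_cellFinalBoxT`).  Definitions that do not depend on the cell are NOT duplicated (they resolve to `RowD`);
proofs are verbatim.  Kept: slot_regime, norm_plain, norm_grad, norm_shift, norm_loop3w_le, norm_loop3u_le.
Prover seat `hubbard-h0-rotor-p2` g8; helper for piece A = stmt-HubbardSuperconductivity-23918 of rung 19089 (`--supports`, helper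
class).  Nothing here proves superconductivity in the Hubbard model; lemmas for ONE row of ONE conditional reduction on the t-blocks;
the rotor TARGET as originally worded stays FALSE (g15 verdict).  Tree imports only; no sorry.
-/

set_option linter.dupNamespace false
set_option autoImplicit false

open scoped BigOperators

namespace Summit.HubbardSuperconductivity.HubbardSuperconductivity.Theorems.AnisotropyChord.Transfer.Fibre3

namespace RowD

namespace T

open RowC L2.N1

variable (L : ℕ) [NeZero L]

/-! ## The typed three-slot products -/

section three
variable (Δ lam2 : ℝ) (f : Tor L → ℝ)

/-- ★ the slot regime of a located ground profile (`L ≥ 128`, `0 ≤ Δ < 1`): `a = Δf(x̂) ≥ 0`, `c_s ≥ 0`, `0 ≤ ν < 4/π²`, `λ₂ < 2ε₁`. [folklore] -/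
theorem slot_regime (hL : 64 ≤ L) (hΔ0 : 0 ≤ Δ) (hΔ1 : Δ < 1) (hf : IsGroundTwoMagnon L Δ lam2 f) :
    0 ≤ Δ * f (K1 L) ∧ 0 ≤ cS L Δ lam2 f ∧ 0 ≤ lam2 / (2 * Real.pi / L) ^ 2 ∧
      lam2 / (2 * Real.pi / L) ^ 2 < 4 / Real.pi ^ 2 ∧ lam2 < 2 * eps1 L := by
  have hfpos : 0 < f (K1 L) := hf.1.2.2.1
  have hlam : 0 < lam2 := lam2_pos L (by omega) hΔ1 hf.1
  have hLpos : (0 : ℝ) < L := by exact_mod_cast (show 0 < L by omega)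
  have ht : 0 < (2 * Real.pi / L : ℝ) ^ 2 := by positivity
  have hνc := ManifoldA.nu_ceiling64 L hL hΔ0 hf
  refine ⟨by positivity, by unfold cS; positivity, by positivity, ?_, lam2_lt_two_eps1 L (by omega) hΔ0 hf⟩
  rw [div_lt_iff₀ ht]
  have hπ2 : Real.pi ^ 2 < 10 := by nlinarith [Real.pi_lt_d2, Real.pi_pos]
  have h4 : (0.0359 : ℝ) < 4 / Real.pi ^ 2 := by rw [lt_div_iff₀ (by positivity)]; nlinarith
  nlinarith

/-- pointwise norm of a plain typed factor. [folklore] -/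
theorem norm_plain (hL : 64 ≤ L) (hΔ0 : 0 ≤ Δ) (hΔ1 : Δ < 1) (hf : IsGroundTwoMagnon L Δ lam2 f) (k : Bool) (e q : Tor L) :
    ‖RfacU L lam2 (psiU L Δ lam2 f k 1 0 e) q‖ = if k then cS L Δ lam2 f * gres L lam2 q else Δ * f (K1 L) := by
  obtain ⟨ha0, hcs0, -, hν, -⟩ := slot_regime L Δ lam2 f hL hΔ0 hΔ1 hf
  cases k
  · rw [norm_rfacU_J L Δ lam2 f ha0, wfac_plain, one_mul]; rfl
  · rw [norm_rfacU_S L Δ lam2 f hcs0 _ _ _ _ (g_nonneg L hν q), wfac_plain, one_mul]; rfl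

/-- pointwise norm of a gradient-weighted typed factor. [folklore] -/
theorem norm_grad (hL : 64 ≤ L) (hΔ0 : 0 ≤ Δ) (hΔ1 : Δ < 1) (hf : IsGroundTwoMagnon L Δ lam2 f) (k : Bool) (e q : Tor L) :
    ‖RfacU L lam2 (psiU L Δ lam2 f k 1 (-1) e) q‖
      = wnorm L q e * (if k then cS L Δ lam2 f * gres L lam2 q else Δ * f (K1 L)) := by
  obtain ⟨ha0, hcs0, -, hν, -⟩ := slot_regime L Δ lam2 f hL hΔ0 hΔ1 hf
  cases k
  · rw [norm_rfacU_J L Δ lam2 f ha0, wfac_grad]; rfl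
  · rw [norm_rfacU_S L Δ lam2 f hcs0 _ _ _ _ (g_nonneg L hν q), wfac_grad]; rfl

/-- pointwise norm of a shifted typed factor. [folklore] -/
theorem norm_shift (hL : 64 ≤ L) (hΔ0 : 0 ≤ Δ) (hΔ1 : Δ < 1) (hf : IsGroundTwoMagnon L Δ lam2 f) (k : Bool) (e q : Tor L) :
    ‖RfacU L lam2 (psiU L Δ lam2 f k 0 1 e) q‖ = if k then cS L Δ lam2 f * gres L lam2 q else Δ * f (K1 L) := by
  obtain ⟨ha0, hcs0, -, hν, -⟩ := slot_regime L Δ lam2 f hL hΔ0 hΔ1 hf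
  cases k
  · rw [norm_rfacU_J L Δ lam2 f ha0, wfac_shift, one_mul]; rfl
  · rw [norm_rfacU_S L Δ lam2 f hcs0 _ _ _ _ (g_nonneg L hν q), wfac_shift, one_mul]; rfl

/-- ★ THE N-TYPE PRODUCT BOUND: `‖Σ_p R_u(affine L σu cu p) R_w(affine L σw cw p) R_w′(ℓw′ p)‖ ≤ bnd3 ku kw kw′` (legs sum-preserving, weight vectors in `E4`). [folklore] -/
theorem norm_loop3w_le (hL : 64 ≤ L) (hΔ0 : 0 ≤ Δ) (hΔ1 : Δ < 1) (hf : IsGroundTwoMagnon L Δ lam2 f) (ku kw kw' : Bool) (eu : Tor L) {ew ew' : ℤ × ℤ}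
    (hew : ew ∈ E4) (hew' : ew' ∈ E4) (σu : Bool) (cu : Tor L) (σw : Bool) (cw : Tor L) (σw' : Bool) (cw' : Tor L) :
    ‖∑ p : Tor L, RfacU L lam2 (psiU L Δ lam2 f ku 1 0 eu) (affine L σu cu p)
        * RfacU L lam2 (psiU L Δ lam2 f kw 1 (-1) (B1.toTor L ew)) (affine L σw cw p)
        * RfacU L lam2 (psiU L Δ lam2 f kw' 1 (-1) (B1.toTor L ew')) (affine L σw' cw' p)‖
      ≤ bnd3At L Δ lam2 f ku kw kw' := by
  obtain ⟨ha0', hcs0', hν0, hν, _⟩ := slot_regime L Δ lam2 f hL hΔ0 hΔ1 hf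
  set a := Δ * f (K1 L) with ha
  set cs := cS L Δ lam2 f with hcs
  set g := gres L lam2 with hg
  have ha0 : 0 ≤ a := ha0'
  have hcs0 : 0 ≤ cs := hcs0'
  have hg0 : ∀ q, 0 ≤ g q := fun q => g_nonneg L hν q
  have hw0 : ∀ q e, 0 ≤ wnorm L q e := fun q e => wnorm_nonneg L q e
  have hw2 : ∀ q e, wnorm L q e ≤ 2 := fun q e => wnorm_le_two L q e
  -- step 1: triangle inequality with the pointwise norms
  refine (norm_sum_le _ _).trans ?_
  simp only [norm_mul, norm_plain L Δ lam2 f hL hΔ0 hΔ1 hf, norm_grad L Δ lam2 f hL hΔ0 hΔ1 hf]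
  -- step 2: the eight cases
  unfold bnd3At bnd3
  cases ku <;> cases kw <;> cases kw' <;>
    simp only [Bool.false_eq_true, if_false, if_true, ← ha, ← hcs, ← hg]
  · -- J J J : a · (w a) · (w a) ≤ a (2a)² V
    calc ∑ p, a * (wnorm L (affine L σw cw p) (B1.toTor L ew) * a) * (wnorm L (affine L σw' cw' p) (B1.toTor L ew') * a)
        ≤ ∑ _p : Tor L, a * (2 * a) * (2 * a) := Finset.sum_le_sum fun p _ => by
          have h1 := hw2 (affine L σw cw p) (B1.toTor L ew); have h2 := hw2 (affine L σw' cw' p) (B1.toTor L ew')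
          have h1' := hw0 (affine L σw cw p) (B1.toTor L ew); have h2' := hw0 (affine L σw' cw' p) (B1.toTor L ew')
          have := mul_le_mul h1 h2 h2' (by norm_num)
          nlinarith [mul_nonneg ha0 (mul_nonneg ha0 ha0)]
      _ = a * (2 * a) ^ 2 * (L : ℝ) ^ 2 := by
          rw [Finset.sum_const, Finset.card_univ, Fintype.card_prod, ZMod.card, nsmul_eq_mul]; push_cast; ring
  · -- J J S : a · (w a) · (w cs g) ≤ a cs (2a) √(cz S1 V)
    have hf := fam_w L hν0 hν σw' cw' hew'
    calc ∑ p, a * (wnorm L (affine L σw cw p) (B1.toTor L ew) * a) * (wnorm L (affine L σw' cw' p) (B1.toTor L ew') * (cs * g (affine L σw' cw' p)))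
        ≤ ∑ p, a * (2 * a) * cs * (wnorm L (affine L σw' cw' p) (B1.toTor L ew') * g (affine L σw' cw' p)) := Finset.sum_le_sum fun p _ => by
          have h1 := hw2 (affine L σw cw p) (B1.toTor L ew)
          have hx : 0 ≤ wnorm L (affine L σw' cw' p) (B1.toTor L ew') * g (affine L σw' cw' p) := mul_nonneg (hw0 _ _) (hg0 _)
          have : a * (wnorm L (affine L σw cw p) (B1.toTor L ew) * a) ≤ a * (2 * a) := by
            nlinarith [mul_nonneg (mul_nonneg ha0 ha0) (sub_nonneg.2 h1)]
          calc a * (wnorm L (affine L σw cw p) (B1.toTor L ew) * a) * (wnorm L (affine L σw' cw' p) (B1.toTor L ew') * (cs * g (affine L σw' cw' p)))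
              = (a * (wnorm L (affine L σw cw p) (B1.toTor L ew) * a)) * cs * (wnorm L (affine L σw' cw' p) (B1.toTor L ew') * g (affine L σw' cw' p)) := by ring
            _ ≤ (a * (2 * a)) * cs * (wnorm L (affine L σw' cw' p) (B1.toTor L ew') * g (affine L σw' cw' p)) := by gcongr
      _ = a * (2 * a) * cs * ∑ p, wnorm L (affine L σw' cw' p) (B1.toTor L ew') * g (affine L σw' cw' p) := by rw [Finset.mul_sum]
      _ ≤ a * (2 * a) * cs * Real.sqrt (cZ (lam2 / (2 * Real.pi / L) ^ 2) * S1n L lam2 * (L : ℝ) ^ 2) := by gcongr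
      _ = a * cs * (2 * a) * Real.sqrt (cZ (lam2 / (2 * Real.pi / L) ^ 2) * S1n L lam2 * (L : ℝ) ^ 2) := by ring
  · -- J S J
    have hf := fam_w L hν0 hν σw cw hew
    calc ∑ p, a * (wnorm L (affine L σw cw p) (B1.toTor L ew) * (cs * g (affine L σw cw p))) * (wnorm L (affine L σw' cw' p) (B1.toTor L ew') * a)
        ≤ ∑ p, a * (2 * a) * cs * (wnorm L (affine L σw cw p) (B1.toTor L ew) * g (affine L σw cw p)) := Finset.sum_le_sum fun p _ => by
          have h2 := hw2 (affine L σw' cw' p) (B1.toTor L ew')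
          have hx : 0 ≤ wnorm L (affine L σw cw p) (B1.toTor L ew) * g (affine L σw cw p) := mul_nonneg (hw0 _ _) (hg0 _)
          have : a * (wnorm L (affine L σw' cw' p) (B1.toTor L ew') * a) ≤ a * (2 * a) := by
            nlinarith [mul_nonneg (mul_nonneg ha0 ha0) (sub_nonneg.2 h2)]
          calc a * (wnorm L (affine L σw cw p) (B1.toTor L ew) * (cs * g (affine L σw cw p))) * (wnorm L (affine L σw' cw' p) (B1.toTor L ew') * a)
              = (a * (wnorm L (affine L σw' cw' p) (B1.toTor L ew') * a)) * cs * (wnorm L (affine L σw cw p) (B1.toTor L ew) * g (affine L σw cw p)) := by ring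
            _ ≤ (a * (2 * a)) * cs * (wnorm L (affine L σw cw p) (B1.toTor L ew) * g (affine L σw cw p)) := by gcongr
      _ = a * (2 * a) * cs * ∑ p, wnorm L (affine L σw cw p) (B1.toTor L ew) * g (affine L σw cw p) := by rw [Finset.mul_sum]
      _ ≤ a * (2 * a) * cs * Real.sqrt (cZ (lam2 / (2 * Real.pi / L) ^ 2) * S1n L lam2 * (L : ℝ) ^ 2) := by gcongr
      _ = a * cs * (2 * a) * Real.sqrt (cZ (lam2 / (2 * Real.pi / L) ^ 2) * S1n L lam2 * (L : ℝ) ^ 2) := by ring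
  · -- J S S : a (w cs g)(w cs g) ≤ a cs² cz S1
    have hf := fam_ww L hν0 hν σw cw σw' cw' hew hew'
    calc ∑ p, a * (wnorm L (affine L σw cw p) (B1.toTor L ew) * (cs * g (affine L σw cw p))) * (wnorm L (affine L σw' cw' p) (B1.toTor L ew') * (cs * g (affine L σw' cw' p)))
        = a * cs ^ 2 * ∑ p, (wnorm L (affine L σw cw p) (B1.toTor L ew) * g (affine L σw cw p)) * (wnorm L (affine L σw' cw' p) (B1.toTor L ew') * g (affine L σw' cw' p)) := by
          rw [Finset.mul_sum]; exact Finset.sum_congr rfl fun p _ => by ring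
      _ ≤ a * cs ^ 2 * (cZ (lam2 / (2 * Real.pi / L) ^ 2) * S1n L lam2) := by gcongr
  · -- S J J : cs g · (w a)(w a) ≤ cs (2a)² S1
    have hf := fam_g L σu cu lam2
    calc ∑ p, cs * g (affine L σu cu p) * (wnorm L (affine L σw cw p) (B1.toTor L ew) * a) * (wnorm L (affine L σw' cw' p) (B1.toTor L ew') * a)
        ≤ ∑ p, cs * (2 * a) ^ 2 * g (affine L σu cu p) := Finset.sum_le_sum fun p _ => by
          have h1 := hw2 (affine L σw cw p) (B1.toTor L ew); have h2 := hw2 (affine L σw' cw' p) (B1.toTor L ew')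
          have h1' := hw0 (affine L σw cw p) (B1.toTor L ew); have h2' := hw0 (affine L σw' cw' p) (B1.toTor L ew')
          have hww : wnorm L (affine L σw cw p) (B1.toTor L ew) * wnorm L (affine L σw' cw' p) (B1.toTor L ew') ≤ 2 * 2 := mul_le_mul h1 h2 h2' (by norm_num)
          have hx : 0 ≤ cs * g (affine L σu cu p) * (a * a) := by have := hg0 (affine L σu cu p); positivity
          calc cs * g (affine L σu cu p) * (wnorm L (affine L σw cw p) (B1.toTor L ew) * a) * (wnorm L (affine L σw' cw' p) (B1.toTor L ew') * a)
              = cs * g (affine L σu cu p) * (a * a) * (wnorm L (affine L σw cw p) (B1.toTor L ew) * wnorm L (affine L σw' cw' p) (B1.toTor L ew')) := by ring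
            _ ≤ cs * g (affine L σu cu p) * (a * a) * (2 * 2) := mul_le_mul_of_nonneg_left hww hx
            _ = cs * (2 * a) ^ 2 * g (affine L σu cu p) := by ring
      _ = cs * (2 * a) ^ 2 * S1n L lam2 := by rw [← Finset.mul_sum, hf]
  · -- S J S : cs g · (w a) · (w cs g) ≤ cs² (2a) √(cz S2 S1)
    have hf := fam_gw L hν0 hν σu cu σw' cw' hew'
    calc ∑ p, cs * g (affine L σu cu p) * (wnorm L (affine L σw cw p) (B1.toTor L ew) * a) * (wnorm L (affine L σw' cw' p) (B1.toTor L ew') * (cs * g (affine L σw' cw' p)))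
        ≤ ∑ p, cs ^ 2 * (2 * a) * (g (affine L σu cu p) * (wnorm L (affine L σw' cw' p) (B1.toTor L ew') * g (affine L σw' cw' p))) := Finset.sum_le_sum fun p _ => by
          have h1 := hw2 (affine L σw cw p) (B1.toTor L ew); have h1' := hw0 (affine L σw cw p) (B1.toTor L ew)
          have hx : 0 ≤ cs ^ 2 * a * (g (affine L σu cu p) * (wnorm L (affine L σw' cw' p) (B1.toTor L ew') * g (affine L σw' cw' p))) := by
            have := hg0 (affine L σu cu p); have := hg0 (affine L σw' cw' p); have := hw0 (affine L σw' cw' p) (B1.toTor L ew'); positivity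
          calc cs * g (affine L σu cu p) * (wnorm L (affine L σw cw p) (B1.toTor L ew) * a) * (wnorm L (affine L σw' cw' p) (B1.toTor L ew') * (cs * g (affine L σw' cw' p)))
              = cs ^ 2 * a * (g (affine L σu cu p) * (wnorm L (affine L σw' cw' p) (B1.toTor L ew') * g (affine L σw' cw' p))) * wnorm L (affine L σw cw p) (B1.toTor L ew) := by ring
            _ ≤ cs ^ 2 * a * (g (affine L σu cu p) * (wnorm L (affine L σw' cw' p) (B1.toTor L ew') * g (affine L σw' cw' p))) * 2 := mul_le_mul_of_nonneg_left h1 hx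
            _ = cs ^ 2 * (2 * a) * (g (affine L σu cu p) * (wnorm L (affine L σw' cw' p) (B1.toTor L ew') * g (affine L σw' cw' p))) := by ring
      _ = cs ^ 2 * (2 * a) * ∑ p, g (affine L σu cu p) * (wnorm L (affine L σw' cw' p) (B1.toTor L ew') * g (affine L σw' cw' p)) := by rw [Finset.mul_sum]
      _ ≤ cs ^ 2 * (2 * a) * Real.sqrt (cZ (lam2 / (2 * Real.pi / L) ^ 2) * S2n L lam2 * S1n L lam2) := by gcongr
  · -- S S J
    have hf := fam_gw L hν0 hν σu cu σw cw hew
    calc ∑ p, cs * g (affine L σu cu p) * (wnorm L (affine L σw cw p) (B1.toTor L ew) * (cs * g (affine L σw cw p))) * (wnorm L (affine L σw' cw' p) (B1.toTor L ew') * a)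
        ≤ ∑ p, cs ^ 2 * (2 * a) * (g (affine L σu cu p) * (wnorm L (affine L σw cw p) (B1.toTor L ew) * g (affine L σw cw p))) := Finset.sum_le_sum fun p _ => by
          have h2 := hw2 (affine L σw' cw' p) (B1.toTor L ew'); have h2' := hw0 (affine L σw' cw' p) (B1.toTor L ew')
          have hx : 0 ≤ cs ^ 2 * a * (g (affine L σu cu p) * (wnorm L (affine L σw cw p) (B1.toTor L ew) * g (affine L σw cw p))) := by
            have := hg0 (affine L σu cu p); have := hg0 (affine L σw cw p); have := hw0 (affine L σw cw p) (B1.toTor L ew); positivity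
          calc cs * g (affine L σu cu p) * (wnorm L (affine L σw cw p) (B1.toTor L ew) * (cs * g (affine L σw cw p))) * (wnorm L (affine L σw' cw' p) (B1.toTor L ew') * a)
              = cs ^ 2 * a * (g (affine L σu cu p) * (wnorm L (affine L σw cw p) (B1.toTor L ew) * g (affine L σw cw p))) * wnorm L (affine L σw' cw' p) (B1.toTor L ew') := by ring
            _ ≤ cs ^ 2 * a * (g (affine L σu cu p) * (wnorm L (affine L σw cw p) (B1.toTor L ew) * g (affine L σw cw p))) * 2 := mul_le_mul_of_nonneg_left h2 hx
            _ = cs ^ 2 * (2 * a) * (g (affine L σu cu p) * (wnorm L (affine L σw cw p) (B1.toTor L ew) * g (affine L σw cw p))) := by ring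
      _ = cs ^ 2 * (2 * a) * ∑ p, g (affine L σu cu p) * (wnorm L (affine L σw cw p) (B1.toTor L ew) * g (affine L σw cw p)) := by rw [Finset.mul_sum]
      _ ≤ cs ^ 2 * (2 * a) * Real.sqrt (cZ (lam2 / (2 * Real.pi / L) ^ 2) * S2n L lam2 * S1n L lam2) := by gcongr
  · -- S S S : cs g (w cs g)(w cs g) ≤ cs³ cz S2
    have hf := fam_gww L hν0 hν σu cu σw cw σw' cw' hew hew'
    calc ∑ p, cs * g (affine L σu cu p) * (wnorm L (affine L σw cw p) (B1.toTor L ew) * (cs * g (affine L σw cw p))) * (wnorm L (affine L σw' cw' p) (B1.toTor L ew') * (cs * g (affine L σw' cw' p)))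
        = cs ^ 3 * ∑ p, g (affine L σu cu p) * (wnorm L (affine L σw cw p) (B1.toTor L ew) * g (affine L σw cw p)) * (wnorm L (affine L σw' cw' p) (B1.toTor L ew') * g (affine L σw' cw' p)) := by
          rw [Finset.mul_sum]; exact Finset.sum_congr rfl fun p _ => by ring
      _ ≤ cs ^ 3 * (cZ (lam2 / (2 * Real.pi / L) ^ 2) * S2n L lam2) := by gcongr

/-- ★ THE M-TYPE PRODUCT BOUND: `‖Σ_p R⁰₃(ℓ₃p) R⁰₁(ℓ₁p) R⁰₂(ℓ₂p)‖ ≤ bndM k3 k1 k2`. [folklore] -/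
theorem norm_loop3u_le (hL : 64 ≤ L) (hΔ0 : 0 ≤ Δ) (hΔ1 : Δ < 1) (hf : IsGroundTwoMagnon L Δ lam2 f) (k3 k1 k2 : Bool) (e3 e1 e2 : Tor L)
    (σ3 : Bool) (c3 : Tor L) (σ1 : Bool) (c1 : Tor L) (σ2 : Bool) (c2 : Tor L) :
    ‖∑ p : Tor L, RfacU L lam2 (psiU L Δ lam2 f k3 1 0 e3) (affine L σ3 c3 p) * RfacU L lam2 (psiU L Δ lam2 f k1 1 0 e1) (affine L σ1 c1 p)
        * RfacU L lam2 (psiU L Δ lam2 f k2 1 0 e2) (affine L σ2 c2 p)‖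
      ≤ bndMAt L Δ lam2 f k3 k1 k2 := by
  obtain ⟨ha0', hcs0', _, hν, hlt⟩ := slot_regime L Δ lam2 f hL hΔ0 hΔ1 hf
  set a := Δ * f (K1 L) with ha
  set cs := cS L Δ lam2 f with hcs
  set g := gres L lam2 with hg
  have ha0 : 0 ≤ a := ha0'
  have hcs0 : 0 ≤ cs := hcs0'
  have hg0 : ∀ q, 0 ≤ g q := fun q => g_nonneg L hν q
  refine (norm_sum_le _ _).trans ?_
  simp only [norm_mul, norm_plain L Δ lam2 f hL hΔ0 hΔ1 hf]
  unfold bndMAt bndM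
  cases k3 <;> cases k1 <;> cases k2 <;>
    simp only [Bool.false_eq_true, if_false, if_true, ← ha, ← hcs, ← hg]
  · -- J J J
    rw [Finset.sum_const, Finset.card_univ, Fintype.card_prod, ZMod.card, nsmul_eq_mul]; push_cast
    nlinarith [mul_nonneg ha0 (mul_nonneg ha0 ha0)]
  · -- J J S
    calc ∑ p, a * a * (cs * g (affine L σ2 c2 p)) = a ^ 2 * cs * ∑ p, g (affine L σ2 c2 p) := by
          rw [Finset.mul_sum]; exact Finset.sum_congr rfl fun p _ => by ring
      _ = a ^ 2 * cs * S1n L lam2 := by rw [fam_g L σ2 c2]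
      _ ≤ a ^ 2 * cs * S1n L lam2 := le_rfl
  · -- J S J
    calc ∑ p, a * (cs * g (affine L σ1 c1 p)) * a = a ^ 2 * cs * ∑ p, g (affine L σ1 c1 p) := by
          rw [Finset.mul_sum]; exact Finset.sum_congr rfl fun p _ => by ring
      _ = a ^ 2 * cs * S1n L lam2 := by rw [fam_g L σ1 c1]
      _ ≤ a ^ 2 * cs * S1n L lam2 := le_rfl
  · -- J S S
    calc ∑ p, a * (cs * g (affine L σ1 c1 p)) * (cs * g (affine L σ2 c2 p)) = a * cs ^ 2 * ∑ p, g (affine L σ1 c1 p) * g (affine L σ2 c2 p) := by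
          rw [Finset.mul_sum]; exact Finset.sum_congr rfl fun p _ => by ring
      _ ≤ a * cs ^ 2 * S2n L lam2 := by have := fam_gg L σ1 c1 σ2 c2 lam2; gcongr
  · -- S J J
    calc ∑ p, cs * g (affine L σ3 c3 p) * a * a = a ^ 2 * cs * ∑ p, g (affine L σ3 c3 p) := by
          rw [Finset.mul_sum]; exact Finset.sum_congr rfl fun p _ => by ring
      _ = a ^ 2 * cs * S1n L lam2 := by rw [fam_g L σ3 c3]
      _ ≤ a ^ 2 * cs * S1n L lam2 := le_rfl
  · -- S J S
    calc ∑ p, cs * g (affine L σ3 c3 p) * a * (cs * g (affine L σ2 c2 p)) = a * cs ^ 2 * ∑ p, g (affine L σ3 c3 p) * g (affine L σ2 c2 p) := by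
          rw [Finset.mul_sum]; exact Finset.sum_congr rfl fun p _ => by ring
      _ ≤ a * cs ^ 2 * S2n L lam2 := by have := fam_gg L σ3 c3 σ2 c2 lam2; gcongr
  · -- S S J
    calc ∑ p, cs * g (affine L σ3 c3 p) * (cs * g (affine L σ1 c1 p)) * a = a * cs ^ 2 * ∑ p, g (affine L σ3 c3 p) * g (affine L σ1 c1 p) := by
          rw [Finset.mul_sum]; exact Finset.sum_congr rfl fun p _ => by ring
      _ ≤ a * cs ^ 2 * S2n L lam2 := by have := fam_gg L σ3 c3 σ1 c1 lam2; gcongr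
  · -- S S S
    calc ∑ p, cs * g (affine L σ3 c3 p) * (cs * g (affine L σ1 c1 p)) * (cs * g (affine L σ2 c2 p)) = cs ^ 3 * ∑ p, g (affine L σ3 c3 p) * g (affine L σ1 c1 p) * g (affine L σ2 c2 p) := by
          rw [Finset.mul_sum]; exact Finset.sum_congr rfl fun p _ => by ring
      _ ≤ cs ^ 3 * (1 / (2 * eps1 L - lam2) * S2n L lam2) := by
          have := fam_ggg L (by omega) hν hlt σ3 c3 σ1 c1 σ2 c2; gcongr

end three

end T

end RowD

end Summit.HubbardSuperconductivity.HubbardSuperconductivity.Theorems.AnisotropyChord.Transfer.Fibre3
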